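import Summits.CriticalPhenomena.SAWScalingLimit.Theorems.IsingBoundaryRatio.Negative.IsingBoundaryRatioNesting
import Summits.CriticalPhenomena.SAWScalingLimit.Theorems.SAWLoopFugacityFlowIsingBoundaryRatioForgettingDefs
import Literature.Probability.RandomPlanarGeometry.SAWScalingLimitFamily
import Literature.Probability.LatticeModels.DiluteLoopModelSAW
import Literature.Probability.LatticeModels.MeshApproximatesPolyomino
import Literature.Probability.LatticeModels.ModifiedSimonInequality

/-!
# Line `fk-anchor-transfer`, stub 1e' (rev 5): repaired arm-origin forgetting ⇒ anchor locality
(crux `SAWLoopFugacityFlow.IsingBoundaryRatio`, stmt-CriticalPhenomena-10650; skeleton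
`Summits/CriticalPhenomena/SAWScalingLimit/Cruxes/IsingBoundaryRatio/Lines/fk_anchor_transfer.lean`)

Lead-1's rev-4 target `ArmOriginForgettingAt` is False (far spins reachable only through vertices outside the
finite volume give a zero two-point function: `not_armOriginForgetting`,
`Theorems/SAWLoopFugacityFlowIsingBoundaryRatioArmOriginForgettingFalse.lean`), which made the rev-4 stub 1e
(`ArmOriginForgetting → AnchorLocality`) vacuous. Rev 5 of the line uses the REPAIRED targets
`ArmOriginForgettingAt'` / `ArmOriginForgetting'` of `…ForgettingDefs.lean` (in-volume walks). This file proves the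
honest stub 1e' (mathematics by the cycle-c1 lead, workfile `Lines/fk_anchor_transfer_c1_repair.lean`, ported to the
tree's definitions by the cycle-c2 lead):

* `freeTwoPoint_pos_of_walk` — an in-volume walk from `x` to `y` gives `0 < freeTwoPoint G Λ x y` (GKS I via the
  high-temperature expansion, `hteSum_pos_of_path`), so the repaired double ratio has no `x / 0` junk;
* `localAgreement_self`, `localAgreement_subdomain` — the crux's two finite-volume graphs
  `(Ω_δ, meshDomainFinset D δ)` and `(Ω'_δ, meshDomainFinset D' δ)` (hull subdomain `D' ⊆ D` agreeing with `D` in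
  `B(p, ε)`) AGREE LOCALLY with `Ω_δ` in `B(p, ε/2)` once `0 < δ < ε/2` and the mesh domains are nested;
* `anchorLocality_of_armOriginForgetting'` — **stub 1e'**: `ArmOriginForgetting' →` anchor locality (the line's
  `AnchorLocality`, lead-0's registered `stub_anchorLocality` statement verbatim).

Sources: the FK heuristics behind the targets are in the Defs file; everything here is elementary lattice
bookkeeping over tree theorems (`discreteDomainGraph_adj_iff`, `meshGraph_adj_iff`, `mem_meshDomain_of_adj`,
`DiluteLoopModel.support_subset_meshDomain`, `Negative.mem_meshDomainFinset_of_reachable_ne`).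
-/

noncomputable section

open scoped Classical Topology
open Filter Set Metric
open Literature.Probability.LatticeModels Literature.Probability.RandomPlanarGeometry

namespace Summit.CriticalPhenomena.SAWScalingLimit.Theorems.IsingBoundaryRatio

open Summit.CriticalPhenomena.SAWScalingLimit.Theorems.IsingBoundaryRatio.Negative

/-! ### No junk: in-volume walks make `τ` positive -/

/-- GKS I for the finite volume `(G, Λ)`: an in-volume walk from `x` to `y` gives `0 < freeTwoPoint G Λ x y`
(high-temperature expansion + path witness, `hteSum_pos_of_path`). -/
theorem freeTwoPoint_pos_of_walk (G : SimpleGraph (Site 2)) [G.LocallyFinite] (Λ : Finset (Site 2))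
    {x y : Site 2} (w : G.Walk x y) (hw : ∀ v ∈ w.support, v ∈ Λ) : 0 < freeTwoPoint G Λ x y := by
  by_cases hne : x = y
  · subst hne
    unfold freeTwoPoint
    rw [isingTwoPoint_self]
    exact one_pos
  have hx : x ∈ Λ := hw _ w.start_mem_support
  have hy : y ∈ Λ := hw _ w.end_mem_support
  unfold freeTwoPoint
  rw [isingTwoPoint_free_eq_hteSum_div _ _ _ hx hy]
  refine div_pos ?_ (hteSum_empty_pos _ _ _)
  have htanh : 0 < Real.tanh criticalBetaTwo := tanh_criticalBetaTwo_pos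
  exact hteSum_pos_of_path _ _ htanh hne w.toPath w.toPath.2
    fun v hv => hw v (SimpleGraph.Walk.support_toPath_subset_support w hv)

/-! ### Local agreement of the crux's two finite-volume graphs -/

/-- `(Ω_δ, meshDomainFinset Ω δ)` agrees locally with `Ω_δ` (everywhere). -/
theorem localAgreement_self {Ω : Set ℂ} (hΩ : Bornology.IsBounded Ω) (p : ℂ) (ε : ℝ) {δ : ℝ}
    (hδ : 0 < δ) : LocalAgreement Ω p ε δ (discreteDomainGraph Ω δ) (meshDomainFinset Ω δ) := by
  intro w _ _ v
  refine ⟨Iff.rfl, fun h => ?_⟩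
  rw [← Finset.mem_coe, coe_meshDomainFinset hΩ hδ]
  exact (discreteDomainGraph_adj_iff.1 h).2.2

/-- **Local agreement of the subdomain graph**: for `D' ⊆ D` with
`D' ∩ B(p, ε) = D ∩ B(p, ε)`, `0 < δ < ε/2` and nested mesh domains, `(Ω'_δ, meshDomainFinset D' δ)`
agrees locally with `Ω_δ` in `B(p, ε/2)`. -/
theorem localAgreement_subdomain {D D' : DobrushinDomain} {p : ℂ} {ε δ : ℝ}
    (hsub : D'.carrier ⊆ D.carrier) (hball : D'.carrier ∩ ball p ε = D.carrier ∩ ball p ε)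
    (hδ : 0 < δ) (hδε : δ < ε / 2) (hnest : meshDomain D'.carrier δ ⊆ meshDomain D.carrier δ) :
    LocalAgreement D.carrier p (ε / 2) δ (discreteDomainGraph D'.carrier δ)
      (meshDomainFinset D'.carrier δ) := by
  have hbdd' : Bornology.IsBounded D'.carrier := D.isBounded.subset hsub
  intro w hw hwball v
  rw [← Finset.mem_coe, coe_meshDomainFinset hbdd' hδ] at hw
  rw [Metric.mem_ball] at hwball
  have key : (discreteDomainGraph D.carrier δ).Adj w v → (discreteDomainGraph D'.carrier δ).Adj w v := by
    intro h
    obtain ⟨hmesh, -, hvD⟩ := discreteDomainGraph_adj_iff.1 h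
    obtain ⟨hzd, hseg⟩ := meshGraph_adj_iff.1 hmesh
    -- both mesh points lie in the ball `B(p, ε)`
    have hwB : meshPoint δ w ∈ ball p ε := by
      rw [Metric.mem_ball]; linarith
    have hvB : meshPoint δ v ∈ ball p ε := by
      rw [Metric.mem_ball]
      have h1 := Polyomino.dist_meshPoint_le_of_adj hδ.le hzd
      have h2 := dist_triangle (meshPoint δ v) (meshPoint δ w) p
      rw [dist_comm (meshPoint δ v) (meshPoint δ w)] at h2
      linarith
    -- the closed segment lies in `closure D ∩ B(p, ε) ⊆ closure D'`
    have hseg' : segment ℝ (meshPoint δ w) (meshPoint δ v) ⊆ closure D'.carrier := by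
      intro z hz
      have hzB : z ∈ ball p ε := (convex_ball p ε).segment_subset hwB hvB hz
      have hzcl : z ∈ closure D.carrier := hseg hz
      have : z ∈ closure (ball p ε ∩ D.carrier) := isOpen_ball.inter_closure ⟨hzB, hzcl⟩
      rw [inter_comm, ← hball] at this
      exact closure_mono inter_subset_left this
    have hmesh' : (meshGraph D'.carrier δ).Adj w v := meshGraph_adj_iff.2 ⟨hzd, hseg'⟩
    -- the far end is a mesh vertex of `D'`, hence in the component of `w`
    have hvD' : v ∈ meshVertices D'.carrier δ := by
      have h1 : meshPoint δ v ∈ D.carrier := meshDomain_subset_meshVertices _ _ hvD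
      have h2 : meshPoint δ v ∈ D'.carrier ∩ ball p ε := by
        rw [hball]; exact ⟨h1, hvB⟩
      exact h2.1
    have hwD' : w ∈ meshVertices D'.carrier δ := meshDomain_subset_meshVertices _ _ hw
    have hadj' : (meshVertexGraph D'.carrier δ).Adj ⟨w, hwD'⟩ ⟨v, hvD'⟩ := by
      simpa only [SimpleGraph.comap_adj, Function.Embedding.subtype_apply] using hmesh'
    have hv' : v ∈ meshDomain D'.carrier δ := mem_meshDomain_of_adj hw hadj'
    exact discreteDomainGraph_adj_iff.2 ⟨hmesh', hw, hv'⟩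
  refine ⟨⟨fun h => discreteDomainGraph_mono hsub hnest h, key⟩, fun h => ?_⟩
  rw [← Finset.mem_coe, coe_meshDomainFinset hbdd' hδ]
  exact (discreteDomainGraph_adj_iff.1 (key h)).2.2

/-! ### The honest stub 1e: repaired arm-origin forgetting ⇒ anchor locality -/

/-- **`ArmOriginForgetting' → AnchorLocality`** (lead-0/lead-1's registered `stub_anchorLocality`
statement, verbatim): apply the repaired forgetting at `D.pt i` with localisation radius `ε/2` to
`(G₁, Λ₁) = (Ω'_δ, meshDomainFinset D' δ)` and `(G₂, Λ₂) = (Ω_δ, meshDomainFinset D δ)` with the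
common far spin `y δ`; the crux's `Ω'_δ`-reachability gives walks with support in `meshDomain D' δ`
(`support_subset_meshDomain`), mapped into `Ω_δ` along `Ω'_δ ≤ Ω_δ`; `freeTwoPoint (Ω_δ) (meshDomainFinset Ω δ) = T Ω δ` by `rfl`. The returned radius is `min r (c/2)` so that `x δ ≠ y δ`. -/
theorem anchorLocality_of_armOriginForgetting' (hA : ArmOriginForgetting') :
    ∀ (D D' : DobrushinDomain) (i : Fin 2) (ε : ℝ), D'.carrier ⊆ D.carrier → 0 < ε →
      D'.carrier ∩ Metric.ball (D.pt i) ε = D.carrier ∩ Metric.ball (D.pt i) ε →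
      ∀ c : ℝ, 0 < c → ∀ η : ℝ, 0 < η → ∃ r : ℝ, 0 < r ∧
        ∀ (x x' y : ℝ → Site 2),
          (∀ᶠ δ in 𝓝[>] (0 : ℝ), dist (meshPoint δ (x δ)) (D.pt i) < r) →
          (∀ᶠ δ in 𝓝[>] (0 : ℝ), dist (meshPoint δ (x' δ)) (D.pt i) < r) →
          (∀ᶠ δ in 𝓝[>] (0 : ℝ), c ≤ dist (meshPoint δ (y δ)) (D.pt i)) →
          (∀ᶠ δ in 𝓝[>] (0 : ℝ), (discreteDomainGraph D'.carrier δ).Reachable (x δ) (y δ) ∧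
            (discreteDomainGraph D'.carrier δ).Reachable (x' δ) (y δ)) →
          (∀ᶠ δ in 𝓝[>] (0 : ℝ), meshDomain D'.carrier δ ⊆ meshDomain D.carrier δ) →
          ∀ᶠ δ in 𝓝[>] (0 : ℝ),
            |T D'.carrier δ (x δ) (y δ) / T D'.carrier δ (x' δ) (y δ) /
                (T D.carrier δ (x δ) (y δ) / T D.carrier δ (x' δ) (y δ)) - 1| < η := by
  intro D D' i ε hsub hε hball c hc η hη
  obtain ⟨r, hr, hev⟩ := hA D i (ε / 2) c η (half_pos hε) hc hη
  refine ⟨min r (c / 2), lt_min hr (half_pos hc), ?_⟩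
  intro x x' y hx hx' hy hreach hnest
  filter_upwards [hev, hx, hx', hy, hreach, hnest, Ioo_mem_nhdsGT (half_pos hε)]
    with δ hP hxδ hx'δ hyδ hrδ hnδ hδ
  have hδ0 : 0 < δ := hδ.1
  have hbdd' : Bornology.IsBounded D'.carrier := D.isBounded.subset hsub
  have hxr : dist (meshPoint δ (x δ)) (D.pt i) < r := lt_of_lt_of_le hxδ (min_le_left _ _)
  have hx'r : dist (meshPoint δ (x' δ)) (D.pt i) < r := lt_of_lt_of_le hx'δ (min_le_left _ _)
  have hxy : x δ ≠ y δ := by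
    intro h
    rw [h] at hxδ
    have := lt_of_lt_of_le hxδ (min_le_right _ _)
    linarith
  have hx'y : x' δ ≠ y δ := by
    intro h
    rw [h] at hx'δ
    have := lt_of_lt_of_le hx'δ (min_le_right _ _)
    linarith
  -- memberships
  obtain ⟨hxm', hym'⟩ := mem_meshDomainFinset_of_reachable_ne hbdd' hδ0 hrδ.1 hxy
  obtain ⟨hx'm', -⟩ := mem_meshDomainFinset_of_reachable_ne hbdd' hδ0 hrδ.2 hx'y
  have hfin : ∀ v, v ∈ meshDomainFinset D'.carrier δ → v ∈ meshDomainFinset D.carrier δ := by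
    intro v hv
    rw [← Finset.mem_coe, coe_meshDomainFinset hbdd' hδ0] at hv
    rw [← Finset.mem_coe, coe_meshDomainFinset D.isBounded hδ0]
    exact hnδ hv
  -- in-volume walks
  have hmono : discreteDomainGraph D'.carrier δ ≤ discreteDomainGraph D.carrier δ :=
    discreteDomainGraph_mono hsub hnδ
  have walks : ∀ {u : Site 2}, u ∈ meshDomainFinset D'.carrier δ →
      (discreteDomainGraph D'.carrier δ).Reachable u (y δ) →
      (∃ w : (discreteDomainGraph D'.carrier δ).Walk u (y δ), ∀ v ∈ w.support, v ∈ meshDomainFinset D'.carrier δ) ∧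
      (∃ w : (discreteDomainGraph D.carrier δ).Walk u (y δ), ∀ v ∈ w.support, v ∈ meshDomainFinset D.carrier δ) := by
    intro u hu hr'
    obtain ⟨w⟩ := hr'
    have hu' : u ∈ meshDomain D'.carrier δ := by
      rw [← Finset.mem_coe, coe_meshDomainFinset hbdd' hδ0] at hu; exact hu
    have hsupp : ∀ v ∈ w.support, v ∈ meshDomainFinset D'.carrier δ := by
      intro v hv
      rw [← Finset.mem_coe, coe_meshDomainFinset hbdd' hδ0]
      exact DiluteLoopModel.support_subset_meshDomain w hu' v hv
    refine ⟨⟨w, hsupp⟩, ⟨w.map (SimpleGraph.Hom.ofLE hmono), ?_⟩⟩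
    intro v hv
    rw [← Finset.mem_coe, coe_meshDomainFinset D.isBounded hδ0]
    exact DiluteLoopModel.support_subset_meshDomain (w.map (SimpleGraph.Hom.ofLE hmono)) (hnδ hu') v hv
  obtain ⟨w₁, w₂⟩ := walks hxm' hrδ.1
  obtain ⟨w₁', w₂'⟩ := walks hx'm' hrδ.2
  have key := hP (discreteDomainGraph D'.carrier δ) (discreteDomainGraph D.carrier δ)
    (meshDomainFinset D'.carrier δ) (meshDomainFinset D.carrier δ) (x δ) (x' δ) (y δ) (y δ)
    (localAgreement_subdomain hsub hball hδ0 hδ.2 hnδ) (localAgreement_self D.isBounded _ _ hδ0)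
    hxm' (hfin _ hxm') hx'm' (hfin _ hx'm') hym' (hfin _ hym') hxr hx'r hyδ hyδ w₁ w₁' w₂ w₂'
  simpa only [freeTwoPoint, T] using key


/-- **Stub 1e' of line `fk-anchor-transfer` (rev 5), registered signature:** `ArmOriginForgetting' →`
anchor locality (= `anchorLocality_of_armOriginForgetting'`). -/
theorem stub_localAgreementTransfer' :
    ArmOriginForgetting' →
    ∀ (D D' : DobrushinDomain) (i : Fin 2) (ε : ℝ), D'.carrier ⊆ D.carrier → 0 < ε →
      D'.carrier ∩ Metric.ball (D.pt i) ε = D.carrier ∩ Metric.ball (D.pt i) ε →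
      ∀ c : ℝ, 0 < c → ∀ η : ℝ, 0 < η → ∃ r : ℝ, 0 < r ∧
        ∀ (x x' y : ℝ → Site 2),
          (∀ᶠ δ in 𝓝[>] (0 : ℝ), dist (meshPoint δ (x δ)) (D.pt i) < r) →
          (∀ᶠ δ in 𝓝[>] (0 : ℝ), dist (meshPoint δ (x' δ)) (D.pt i) < r) →
          (∀ᶠ δ in 𝓝[>] (0 : ℝ), c ≤ dist (meshPoint δ (y δ)) (D.pt i)) →
          (∀ᶠ δ in 𝓝[>] (0 : ℝ), (discreteDomainGraph D'.carrier δ).Reachable (x δ) (y δ) ∧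
            (discreteDomainGraph D'.carrier δ).Reachable (x' δ) (y δ)) →
          (∀ᶠ δ in 𝓝[>] (0 : ℝ), meshDomain D'.carrier δ ⊆ meshDomain D.carrier δ) →
          ∀ᶠ δ in 𝓝[>] (0 : ℝ),
            |T D'.carrier δ (x δ) (y δ) / T D'.carrier δ (x' δ) (y δ) /
                (T D.carrier δ (x δ) (y δ) / T D.carrier δ (x' δ) (y δ)) - 1| < η :=
  anchorLocality_of_armOriginForgetting'

end Summit.CriticalPhenomena.SAWScalingLimit.Theorems.IsingBoundaryRatio

end
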